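import Mathlib
import Literature.NumberTheory.LFunctions.Zhang2022.TypedSection17
import Literature.NumberTheory.LFunctions.Zhang2022.Section10CRanges1422
import Literature.NumberTheory.LFunctions.Zhang2022.Section9GatheringCore
import Literature.NumberTheory.LFunctions.Zhang2022.Section8FrontEnd44Sizes
import Literature.NumberTheory.LFunctions.Zhang2022.TypedSection12A
import Literature.NumberTheory.LFunctions.Zhang2022.TypedSection01and02B
import Literature.NumberTheory.LFunctions.Zhang2022.SkeletonWindowPowers
import HarnessLib

/-!
# Zhang 2022, §17 (17.4): the `D`-dependent display `𝔢₀(D)` vs the tree's constant `𝔢₀`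

(17.4) as printed defines `𝔢₀ = (ϰ₁(1) + ι₂ϰ₂(1))(ῑ₃ϰ₃(1) + ῑ₄ϰ₄(1))` with the functions `ϰ_j` of (8.6)
evaluated at `1` (`Typed.Section17.frake0D D`).  Here `ϰ₁(1) = P₁^{β₆} = e^{0.756πi}` and
`ϰ₃(1) = P₃^{β₆} = e^{0.747πi}` are `D`-free, while `ϰ₂(1) = P₂^{β₇} = e^{1.25πi}·T^{−10β₇}` carries the
factor `T^{−10β₇} = exp(−25πi·𝓛^{1.1}/𝓛⁹) = 1 + O(𝓛^{−7.9})` (`P₂ = P^{1/2}T^{−10}`, `T = e^{𝓛^{1.1}}`,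
`P = e^{𝓛⁹}`, `β₇ = 5iα/2`, `α = π/log P`).  The tree's constant `Section18Defs.frake0` is the `D`-free
main term (`ϰ₂(1) ↦ e^{1.25πi}`; `ϰ₄ := ϰ₂`).  This file proves the exact values and the comparison
`‖𝔢₀(D) − 𝔢₀‖ ≤ C·𝓛^{1.1}/𝓛⁹`, the input the §17.u007 evaluation (`Typed.Section17.Step17_u007`,
leaf `h17_6`) needs to pass from the `D`-dependent product of the `ϰ_j(1)` to `frake0`.

Helper under leaf `h17_6` (`Typed.Section17.Eq17_6Rel`), ZHANG-L WP16; theorems only.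
[cite: Zhang2022LandauSiegel, §17 (17.4) p.96, tex L4741; §8 (8.6) p.44; §2 (2.21)–(2.22)]
-/

noncomputable section

open Complex Real ComplexConjugate
open Literature.NumberTheory.LFunctions.Zhang2022
open Literature.NumberTheory.LFunctions.Zhang2022.Skeleton

namespace Literature.NumberTheory.LFunctions.Zhang2022.Typed.Section17

variable {D : ℕ}

/-! ## Parameter bookkeeping -/

/-- For a positive real `x` and complex `w`: `(x : ℂ)^w = exp(w · log x)` with the REAL logarithm.
[folklore] -/
private theorem ofReal_cpow_eq_cexp {x : ℝ} (hx : 0 < x) (w : ℂ) :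
    ((x : ℝ) : ℂ) ^ w = cexp (w * (Real.log x : ℂ)) := by
  rw [Complex.cpow_def_of_ne_zero (by exact_mod_cast hx.ne'), Complex.ofReal_log hx.le, mul_comm]

/-- `1 < P₁` once `𝓛 ≥ 3`. [cite: Zhang2022LandauSiegel, §2 (2.21)] -/
theorem one_lt_P1' (hL : 3 ≤ ell D) : 1 < Skeleton.P1 D := by
  have hℓ : 0 < ell D := by linarith
  have : 0 < Real.log (Skeleton.P1 D) := by rw [Typed.Sec12A.log_P1]; positivity
  exact (Real.log_pos_iff (by rw [Skeleton.P1]; exact (Real.rpow_pos_of_pos (Skeleton.bigP_pos D) _).le)).mp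
    this

/-! ## The values `ϰ_j(1)` -/

/-- `ϰ₁(1) = P₁^{β₆} = e^{0.756πi}` exactly (`log P₁ = 0.504𝓛⁹`, `β₆ = 3iα/2`, `α𝓛⁹ = π`), for `𝓛 ≥ 3`.
[cite: Zhang2022LandauSiegel, §8 (8.6) p.44; (17.4) p.96] -/
theorem vk1_one (hL : 3 ≤ ell D) : vk1 D 1 = vk1one := by
  have hℓ : 0 < ell D := by linarith
  have hP1 : 1 < Skeleton.P1 D := one_lt_P1' hL
  have hP0 : 0 < Skeleton.P1 D := by linarith
  rw [vk1, if_pos (by exact_mod_cast hP1)]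
  simp only [Nat.cast_one, Real.log_one, zero_div, sub_zero, div_one, Complex.ofReal_one, one_mul]
  rw [ofReal_cpow_eq_cexp hP0, Typed.Sec12A.log_P1, vk1one, beta6, Section2.alpha_eq_pi_div_ell9]
  congr 1
  have h9 : (ell D : ℂ) ≠ 0 := by exact_mod_cast hℓ.ne'
  push_cast
  field_simp
  ring

/-- `ϰ₃(1) = P₃^{β₆} = e^{0.747πi}` exactly (`log P₃ = 0.498𝓛⁹`), for `𝓛 ≥ 3`.
[cite: Zhang2022LandauSiegel, §8 (8.6) p.44; (17.4) p.96] -/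
theorem vk3_one (hL : 3 ≤ ell D) : vk3 D 1 = vk3one := by
  have hℓ : 0 < ell D := by linarith
  have hP3 : 1 < Skeleton.P3 D := Sec10C.Ranges1422.one_lt_P3 hL
  have hP0 : 0 < Skeleton.P3 D := by linarith
  rw [vk3, if_pos (by exact_mod_cast hP3)]
  simp only [Nat.cast_one, Real.log_one, zero_div, sub_zero, div_one, Complex.ofReal_one, one_mul]
  rw [ofReal_cpow_eq_cexp hP0, Sec10C.Ranges1422.log_P3_eq, vk3one, beta6, Section2.alpha_eq_pi_div_ell9]
  congr 1
  have h9 : (ell D : ℂ) ≠ 0 := by exact_mod_cast hℓ.ne'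
  push_cast
  field_simp
  ring

/-- `0 ≤ θ(D) := 25π𝓛^{1.1}/𝓛⁹` (the phase of `T^{−10β₇} = e^{−iθ(D)}`). [cite: Zhang2022LandauSiegel, (17.4) p.96] -/
theorem thetaT_nonneg (hL : 3 ≤ ell D) : 0 ≤ 25 * π * ell D ^ (1.1 : ℝ) / ell D ^ 9 := by
  have hℓ : 0 ≤ ell D := by linarith
  positivity

/-- `ϰ₂(1) = P₂^{β₇} = e^{1.25πi} · e^{−iθ(D)}`, `θ(D) = 25π𝓛^{1.1}/𝓛⁹`, i.e. `P₂^{β₇} = e^{1.25πi}T^{−10β₇}`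
(`log P₂ = 𝓛⁹/2 − 10𝓛^{1.1}`, `β₇ = 5iα/2`), for `𝓛 ≥ 3`.
[cite: Zhang2022LandauSiegel, §8 (8.6) p.44; (17.4) p.96] -/
theorem vk2_one_eq (hL : 3 ≤ ell D) :
    vk2 D 1 = vk2one * cexp (-((25 * π * ell D ^ (1.1 : ℝ) / ell D ^ 9 : ℝ) : ℂ) * I) := by
  have hℓ : 0 < ell D := by linarith
  have hP2 : 1 < Skeleton.P2 D := Sec10C.Ranges1422.one_lt_P2 hL
  have hP0 : 0 < Skeleton.P2 D := by linarith
  rw [vk2, if_pos (by exact_mod_cast hP2)]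
  simp only [Nat.cast_one, Real.log_one, zero_div, sub_zero, div_one, Complex.ofReal_one, one_mul]
  rw [ofReal_cpow_eq_cexp hP0, Sec10C.Ranges1422.log_P2_eq, vk2one, ← Complex.exp_add, beta7,
    Section2.alpha_eq_pi_div_ell9]
  congr 1
  have h9 : (ell D : ℂ) ≠ 0 := by exact_mod_cast hℓ.ne'
  push_cast
  field_simp
  ring

/-- `ϰ₄(1) = ϰ₂(1)` (the tree's reading `ϰ₄ := ϰ₂`). [cite: Zhang2022LandauSiegel, (17.4), (2.27)] -/
theorem vk4_one_eq (D : ℕ) : vk4 D 1 = vk2 D 1 := rfl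

/-- `‖e^{−iθ(D)}‖ = 1`. [folklore] -/
private theorem norm_cexp_neg_thetaT_mul_I (D : ℕ) :
    ‖cexp (-((25 * π * ell D ^ (1.1 : ℝ) / ell D ^ 9 : ℝ) : ℂ) * I)‖ = 1 := by
  rw [show -((25 * π * ell D ^ (1.1 : ℝ) / ell D ^ 9 : ℝ) : ℂ) * I = ((-(25 * π * ell D ^ (1.1 : ℝ) / ell D ^ 9) : ℝ) : ℂ) * I by push_cast; ring]
  exact Complex.norm_exp_ofReal_mul_I _

/-- `‖e^{1.25πi}‖ = 1` (the main-term value of `ϰ₂(1)`). [cite: Zhang2022LandauSiegel, §8 (8.6) p.44; (17.4) p.96] -/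
theorem norm_vk2one : ‖vk2one‖ = 1 := by
  rw [vk2one, show (1.25 : ℂ) * π * I = ((1.25 * π : ℝ) : ℂ) * I by push_cast; ring]
  exact Complex.norm_exp_ofReal_mul_I _

/-- `‖ϰ₂(1)‖ = 1`, for `𝓛 ≥ 3`. [cite: Zhang2022LandauSiegel, §8 (8.6) p.44] -/
theorem norm_vk2_one (hL : 3 ≤ ell D) : ‖vk2 D 1‖ = 1 := by
  rw [vk2_one_eq hL, norm_mul, norm_vk2one, norm_cexp_neg_thetaT_mul_I, one_mul]

/-- `‖ϰ₂(1) − e^{1.25πi}‖ ≤ θ(D) = 25π𝓛^{1.1}/𝓛⁹` (`|e^{−iθ} − 1| ≤ |θ|`), for `𝓛 ≥ 3`.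
[cite: Zhang2022LandauSiegel, §8 (8.6) p.44; (17.4) p.96] -/
theorem norm_vk2_one_sub_vk2one_le (hL : 3 ≤ ell D) :
    ‖vk2 D 1 - vk2one‖ ≤ 25 * π * ell D ^ (1.1 : ℝ) / ell D ^ 9 := by
  rw [vk2_one_eq hL]
  have h1 : ‖vk2one‖ = 1 := norm_vk2one
  have h2 : ‖cexp (-((25 * π * ell D ^ (1.1 : ℝ) / ell D ^ 9 : ℝ) : ℂ) * I) - 1‖ ≤ 25 * π * ell D ^ (1.1 : ℝ) / ell D ^ 9 := by
    have := Real.norm_exp_I_mul_ofReal_sub_one_le (x := -(25 * π * ell D ^ (1.1 : ℝ) / ell D ^ 9))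
    rw [Real.norm_eq_abs, abs_neg, abs_of_nonneg (thetaT_nonneg hL)] at this
    simpa [mul_comm] using this
  calc ‖vk2one * cexp (-((25 * π * ell D ^ (1.1 : ℝ) / ell D ^ 9 : ℝ) : ℂ) * I) - vk2one‖
      = ‖vk2one * (cexp (-((25 * π * ell D ^ (1.1 : ℝ) / ell D ^ 9 : ℝ) : ℂ) * I) - 1)‖ := by ring_nf
    _ = ‖cexp (-((25 * π * ell D ^ (1.1 : ℝ) / ell D ^ 9 : ℝ) : ℂ) * I) - 1‖ := by rw [norm_mul, h1, one_mul]
    _ ≤ 25 * π * ell D ^ (1.1 : ℝ) / ell D ^ 9 := h2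

/-! ## `𝔢₀(D)` vs `𝔢₀` -/

/-- Unit sizes of the three `D`-free values. [cite: Zhang2022LandauSiegel, (17.4) p.96] -/
theorem norm_vkone : ‖vk1one‖ = 1 ∧ ‖vk2one‖ = 1 ∧ ‖vk3one‖ = 1 := by
  refine ⟨?_, ?_, ?_⟩
  · rw [vk1one, show (0.756 : ℂ) * π * I = ((0.756 * π : ℝ) : ℂ) * I by push_cast; ring]
    exact Complex.norm_exp_ofReal_mul_I _
  · rw [vk2one, show (1.25 : ℂ) * π * I = ((1.25 * π : ℝ) : ℂ) * I by push_cast; ring]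
    exact Complex.norm_exp_ofReal_mul_I _
  · rw [vk3one, show (0.747 : ℂ) * π * I = ((0.747 * π : ℝ) : ℂ) * I by push_cast; ring]
    exact Complex.norm_exp_ofReal_mul_I _

/-- The algebra of the comparison: with `δ = ϰ₂(1) − e^{1.25πi}`,
`𝔢₀(D) − 𝔢₀ = δ · (ϰ₁(1)ῑ₄ + ι₂ῑ₃ϰ₃(1) + ι₂ῑ₄(ϰ₂(1) + e^{1.25πi}))`, for `𝓛 ≥ 3`.
[cite: Zhang2022LandauSiegel, (17.4) p.96] -/
theorem frake0D_sub_frake0_eq (hL : 3 ≤ ell D) :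
    frake0D D - frake0 =
      (vk2 D 1 - vk2one) *
        (vk1one * conj iota4 + iota2 * (conj iota3 * vk3one) + iota2 * conj iota4 * (vk2 D 1 + vk2one)) := by
  rw [frake0D, frake0, vk4_one_eq, vk1_one hL, vk3_one hL, vk4one]
  ring

/-- **`‖𝔢₀(D) − 𝔢₀‖ ≤ 13 · θ(D) = 325π · 𝓛^{1.1}/𝓛⁹`** for `𝓛 ≥ 3`: the `D`-dependent display (17.4)
differs from the tree's constant `frake0` only through `T^{−10β₇} = 1 + O(𝓛^{−7.9})` in `ϰ₂(1) = ϰ₄(1)`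
(`‖ι₂‖ ≤ 2`, `‖ι₃‖ ≤ 1.1`, `‖ι₄‖ ≤ 2`). [cite: Zhang2022LandauSiegel, §17 (17.4) p.96, tex L4741] -/
theorem norm_frake0D_sub_frake0_le_thetaT (hL : 3 ≤ ell D) :
    ‖frake0D D - frake0‖ ≤ 13 * (25 * π * ell D ^ (1.1 : ℝ) / ell D ^ 9) := by
  rw [frake0D_sub_frake0_eq hL, norm_mul]
  obtain ⟨h1, h2, h3⟩ := norm_vkone
  have hi2 : ‖iota2‖ ≤ 2 := Section8FrontEnd44Sizes.norm_iota2_le_two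
  have hi3 : ‖conj iota3‖ ≤ 1.1 := by rw [Complex.norm_conj]; exact Section9Gathering.norm_iota3_le
  have hi4 : ‖conj iota4‖ ≤ 2 := by rw [Complex.norm_conj]; exact Section9Gathering.norm_iota4_le_two
  have hv2 : ‖vk2 D 1‖ = 1 := norm_vk2_one hL
  have hK : ‖vk1one * conj iota4 + iota2 * (conj iota3 * vk3one) +
      iota2 * conj iota4 * (vk2 D 1 + vk2one)‖ ≤ 13 := by
    calc ‖vk1one * conj iota4 + iota2 * (conj iota3 * vk3one) + iota2 * conj iota4 * (vk2 D 1 + vk2one)‖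
        ≤ ‖vk1one * conj iota4‖ + ‖iota2 * (conj iota3 * vk3one)‖ +
            ‖iota2 * conj iota4 * (vk2 D 1 + vk2one)‖ := norm_add₃_le
      _ ≤ 1 * 2 + 2 * (1.1 * 1) + 2 * 2 * (1 + 1) := by
          gcongr
          · rw [norm_mul, h1]; gcongr
          · rw [norm_mul, norm_mul, h3]; gcongr
          · rw [norm_mul, norm_mul]
            gcongr
            exact (norm_add_le _ _).trans (by rw [hv2, h2])
      _ ≤ 13 := by norm_num
  have hθ := thetaT_nonneg hL
  calc ‖vk2 D 1 - vk2one‖ * ‖vk1one * conj iota4 + iota2 * (conj iota3 * vk3one) +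
        iota2 * conj iota4 * (vk2 D 1 + vk2one)‖
      ≤ 25 * π * ell D ^ (1.1 : ℝ) / ell D ^ 9 * 13 := mul_le_mul (norm_vk2_one_sub_vk2one_le hL) hK (norm_nonneg _) hθ
    _ = 13 * (25 * π * ell D ^ (1.1 : ℝ) / ell D ^ 9) := by ring

/-- **`‖𝔢₀(D) − 𝔢₀‖ ≤ C · 𝓛^{1.1} · (𝓛⁹)⁻¹`** (`C = 325π`), all `D` with `𝓛 = log D ≥ 3`.
[cite: Zhang2022LandauSiegel, §17 (17.4) p.96, tex L4741] -/
theorem norm_frake0D_sub_frake0_le :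
    ∃ C : ℝ, 0 ≤ C ∧ ∀ D : ℕ, 3 ≤ ell D →
      ‖frake0D D - frake0‖ ≤ C * ell D ^ (1.1 : ℝ) * (ell D ^ 9)⁻¹ := by
  refine ⟨13 * (25 * π), by positivity, fun D hL => ?_⟩
  refine (norm_frake0D_sub_frake0_le_thetaT hL).trans (le_of_eq ?_)
  ring

/-- **`‖𝔢₀(D) − 𝔢₀‖ ≤ C · 𝓛^{−7.9}`** in rpow form, all `D` with `𝓛 ≥ 3`.
[cite: Zhang2022LandauSiegel, §17 (17.4) p.96, tex L4741] -/
theorem norm_frake0D_sub_frake0_le_rpow :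
    ∃ C : ℝ, 0 ≤ C ∧ ∀ D : ℕ, 3 ≤ ell D →
      ‖frake0D D - frake0‖ ≤ C * ell D ^ (-(7.9 : ℝ)) := by
  obtain ⟨C, hC, h⟩ := norm_frake0D_sub_frake0_le
  refine ⟨C, hC, fun D hL => (h D hL).trans (le_of_eq ?_)⟩
  have hℓ : 0 < ell D := by linarith
  have h9 : ell D ^ (9 : ℝ) = ell D ^ (9 : ℕ) := by exact_mod_cast Real.rpow_natCast (ell D) 9
  rw [show (-(7.9 : ℝ)) = (1.1 : ℝ) - 9 by norm_num, Real.rpow_sub hℓ, h9, div_eq_mul_inv, mul_assoc]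

/-- **Eventual form** (`ForAllLarge`): for all large `D` (and every real primitive `χ (mod D)`),
`‖𝔢₀(D) − 𝔢₀‖ ≤ C · 𝓛^{1.1} · (𝓛⁹)⁻¹`. [cite: Zhang2022LandauSiegel, §17 (17.4) p.96, tex L4741] -/
theorem frake0D_sub_frake0_forAllLarge :
    ∃ C : ℝ, 0 ≤ C ∧ ForAllLarge fun D _ _ =>
      ‖frake0D D - frake0‖ ≤ C * ell D ^ (1.1 : ℝ) * (ell D ^ 9)⁻¹ := by
  obtain ⟨C, hC, h⟩ := norm_frake0D_sub_frake0_le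
  refine ⟨C, hC, ⌈Real.exp 3⌉₊, fun D _ _ hD _ _ => h D ?_⟩
  exact Section8FrontEnd44Reduction.three_le_ell hD

end Literature.NumberTheory.LFunctions.Zhang2022.Typed.Section17

end
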